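import Summits.Ventures.YMGap.FlowData.EigenRadiusCertificate

/-!
# Venture YMGap, track Y3 FLOW-DATA — lineage C's block enclosure of record (the «Ostrowski–Weyl» interval) is an
# index-wise enclosure: reduction to the typed Kahan radius

HONEST FRAMING: venture file of the cell `pub-ymgap` (QuantumFields programme), track Y3.  Lineage C (engine-3; kernels
«sce-onesite3» `os3k` for the 1³ (d = 4) one-site torus and «sce-onesite2x» `x2` for 1² (d = 3); publication script
`engine/sce/results-Y3/onesite3/code/certify.py`, function `block_enclosures`) prints, for every symmetry block of the kept
matrix, from a floating-point eigendecomposition `(X, L)` of the assembled block `A` and three certified norms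
`α ≥ ‖Xᵀ X − 1‖_F` (`alpha`), `δ ≥ ‖A X − X·diag L‖_F` (`delta`), `E_F ≥ ‖S − A‖_F` (`EF`, the a-priori assembly bound; `S` =
the exact block), the index-wise interval

  `λ↓ᵢ(S) ∈ [ min((lᵢ − ρ)/(1 + α), (lᵢ − ρ)/(1 − α)) − E_F ,  max((lᵢ + ρ)/(1 − α), (lᵢ + ρ)/(1 + α)) + E_F ]`,
  `ρ = α·Lmax + (1 + α/2)·δ`,  `Lmax = max |L|`,  `lᵢ` = the `i`-th largest computed eigenvalue,

derived in the engine's notes from Ostrowski's congruence theorem for `Xᵀ S X` and Weyl's inequality.  THIS FILE proves that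
this printed interval IS an enclosure of `λ↓ᵢ(S)`, by reduction to the tree's typed KAHAN radius of lineage B
(`EigenRadius.abs_eigenvalues₀_sub_le_kahanRadius`: `|λ↓ᵢ(S) − λ↓ᵢ(diag L)| ≤ (δ + E_F √(1 + α))/√(1 − α)`, Stewart–Sun
Thm IV.5.4) plus real arithmetic, under the side condition `6 (δ + E_F) ≤ lᵢ + Lmax` and `α ≤ 1/2` — i.e.
whenever the residuals are below the eigenvalue scale, which holds at every block of record by ten or more orders of magnitude
(`δ, E_F ≲ 10⁻¹²`, `lᵢ + Lmax ≳ 10⁻¹` for the quoted tops; the engine re-checks it numerically when citing this file):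

* `sqrt_one_add_le`, `one_sub_le_sqrt_one_sub`, `kahanRadius_le` — `(δ + E_F √(1+α))/√(1−α) ≤ (δ + E_F (1 + α/2))/(1 − α)`;
* `eigenvalues₀_le_record_hi`, `record_lo_le_eigenvalues₀`, `eigenvalues₀_mem_Icc_record` — the interval of record encloses.

So a lineage-C eigenvalue row of record = this theorem (block) + the plaquette-character truncation shift `τ_N` (a Weyl shift
by an operator-norm bound, hypothesis) + the kept-set tail `KWeightTail.eigenvalues₀_mem_Icc` (TAIL-A, typed) — modulo the
program's interval arithmetic for `α, δ, E_F`, exactly as for lineages A (`RitzDeflationCertificate`) and B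
(`EigenRadiusCertificate`).  No lattice object, no number, no row, nothing about limits or a mass gap.

References: G. W. Stewart, J.-G. Sun, *Matrix Perturbation Theory* (1990), Thm IV.5.4 [cite: StewartSun1990, Thm IV.5.4];
R. A. Horn, C. R. Johnson, *Matrix Analysis*, 2nd ed. (2013), Thm 4.3.1 (Weyl), Thm 4.5.9 (Ostrowski) [cite: HornJohnson2013,
Thm 4.5.9]; the cell's `certify.py` (2026-08-23) and FLOW-REFEREE.md FR-49/FR-50 (first lineage-C cells of record).
-/

noncomputable section

open Matrix
open scoped InnerProductSpace

namespace Summit.Ventures.YMGap.FlowData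

namespace OstrowskiWeylRecord

/-! ### Real arithmetic: the Kahan radius is below a square-root-free majorant -/

/-- `√(1 + α) ≤ 1 + α/2` for `α ≥ 0`. [folklore] -/
theorem sqrt_one_add_le {α : ℝ} (hα : 0 ≤ α) : Real.sqrt (1 + α) ≤ 1 + α / 2 := by
  rw [Real.sqrt_le_left (by linarith)]
  nlinarith [sq_nonneg α]

/-- `1 − α ≤ √(1 − α)` for `0 ≤ α ≤ 1`. [folklore] -/
theorem one_sub_le_sqrt_one_sub {α : ℝ} (hα : 0 ≤ α) (hα1 : α ≤ 1) : 1 - α ≤ Real.sqrt (1 - α) := by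
  rw [Real.le_sqrt (by linarith) (by linarith)]
  nlinarith

/-- **Square-root-free majorant of the Kahan radius:** for `0 ≤ α < 1`, `δ, E_F ≥ 0`,
`(δ + E_F √(1 + α))/√(1 − α) ≤ (δ + E_F (1 + α/2))/(1 − α)`. [folklore] -/
theorem kahanRadius_le {α δ EF : ℝ} (hα : 0 ≤ α) (hα1 : α < 1) (hδ : 0 ≤ δ) (hEF : 0 ≤ EF) :
    (δ + EF * Real.sqrt (1 + α)) / Real.sqrt (1 - α) ≤ (δ + EF * (1 + α / 2)) / (1 - α) := by
  have h1 : 0 < 1 - α := by linarith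
  have hs : 0 < Real.sqrt (1 - α) := Real.sqrt_pos.mpr h1
  have hnum : δ + EF * Real.sqrt (1 + α) ≤ δ + EF * (1 + α / 2) := by
    have := sqrt_one_add_le hα
    nlinarith [hEF]
  have hnum0 : 0 ≤ δ + EF * (1 + α / 2) := by positivity
  calc (δ + EF * Real.sqrt (1 + α)) / Real.sqrt (1 - α) ≤ (δ + EF * (1 + α / 2)) / Real.sqrt (1 - α) :=
        div_le_div_of_nonneg_right hnum hs.le
    _ ≤ (δ + EF * (1 + α / 2)) / (1 - α) :=
        div_le_div_of_nonneg_left hnum0 h1 (one_sub_le_sqrt_one_sub hα hα1.le)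

/-- **Upper arithmetic.**  With `ρ = α Lmax + (1 + α/2) δ`, `0 ≤ α ≤ 1/2`, `δ, E_F ≥ 0` and the side condition
`6 (δ + E_F) ≤ l + Lmax` (any real `Lmax`; the program's is `max |L| ≥ |l|`): `l + (δ + E_F (1 + α/2))/(1 − α) ≤ (l + ρ)/(1 − α) + E_F`. [folklore] -/
theorem add_majorant_le_hi {α δ EF l Lmax : ℝ} (hα : 0 ≤ α) (hα2 : α ≤ 1 / 2) (hδ : 0 ≤ δ) (hEF : 0 ≤ EF)
    (hside : 6 * (δ + EF) ≤ l + Lmax) :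
    l + (δ + EF * (1 + α / 2)) / (1 - α) ≤ (l + (α * Lmax + (1 + α / 2) * δ)) / (1 - α) + EF := by
  have h1 : 0 < 1 - α := by linarith
  rw [div_add' _ _ _ h1.ne', ← sub_nonneg]
  have key : 0 ≤ ((l + (α * Lmax + (1 + α / 2) * δ)) + EF * (1 - α)) - (l * (1 - α) + (δ + EF * (1 + α / 2))) := by
    nlinarith [mul_nonneg hα (by linarith : (0:ℝ) ≤ l + Lmax - 6 * (δ + EF)), mul_nonneg hα hδ, mul_nonneg hα hEF]
  have e : (l + (α * Lmax + (1 + α / 2) * δ) + EF * (1 - α)) / (1 - α) - (l + (δ + EF * (1 + α / 2)) / (1 - α)) =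
      (((l + (α * Lmax + (1 + α / 2) * δ)) + EF * (1 - α)) - (l * (1 - α) + (δ + EF * (1 + α / 2)))) / (1 - α) := by
    field_simp
  rw [e]
  exact div_nonneg key h1.le

/-- **Lower arithmetic.**  Same data: `(l − ρ)/(1 + α) − E_F ≤ l − (δ + E_F (1 + α/2))/(1 − α)`. [folklore] -/
theorem lo_le_sub_majorant {α δ EF l Lmax : ℝ} (hα : 0 ≤ α) (hα2 : α ≤ 1 / 2) (hδ : 0 ≤ δ) (hEF : 0 ≤ EF)
    (hside : 6 * (δ + EF) ≤ l + Lmax) :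
    (l - (α * Lmax + (1 + α / 2) * δ)) / (1 + α) - EF ≤ l - (δ + EF * (1 + α / 2)) / (1 - α) := by
  have h1 : 0 < 1 - α := by linarith
  have h2 : 0 < 1 + α := by linarith
  rw [← sub_nonneg]
  have key : 0 ≤ (l * (1 - α) - (δ + EF * (1 + α / 2))) * (1 + α) - ((l - (α * Lmax + (1 + α / 2) * δ)) - EF * (1 + α)) * (1 - α) := by
    have hg : (0:ℝ) ≤ l + Lmax - 6 * (δ + EF) := by linarith
    nlinarith [mul_nonneg hα hg, mul_nonneg hα hδ, mul_nonneg hα hEF, mul_nonneg (mul_nonneg hα hα) hδ,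
      mul_nonneg (mul_nonneg hα hα) hEF, mul_nonneg (mul_nonneg hα hα) hg]
  have e : l - (δ + EF * (1 + α / 2)) / (1 - α) - ((l - (α * Lmax + (1 + α / 2) * δ)) / (1 + α) - EF) =
      ((l * (1 - α) - (δ + EF * (1 + α / 2))) * (1 + α) - ((l - (α * Lmax + (1 + α / 2) * δ)) - EF * (1 + α)) * (1 - α)) /
        ((1 - α) * (1 + α)) := by
    field_simp
  rw [e]
  exact div_nonneg key (mul_pos h1 h2).le

/-! ### The enclosure of record -/

variable {𝕜 : Type*} [RCLike 𝕜] {m : Type*} [Fintype m] [DecidableEq m]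

/-- **Lineage C's block interval of record encloses index-wise.**  `S` Hermitian (the exact kept block), `A` any matrix (the
assembled floating-point block), `X` any matrix and `L` real (computed eigenpairs) with `Σ‖(S − A)ᵢⱼ‖² ≤ E_F²`,
`Σ‖(A X − X·diag L)ᵢⱼ‖² ≤ δ²`, `Σ‖(Xᴴ X − 1)ᵢⱼ‖² ≤ α²`, `0 ≤ α ≤ 1/2`, `δ, E_F ≥ 0`; let `lᵢ = λ↓ᵢ(diag L)` (the `i`-th
largest computed eigenvalue) and assume the side condition `6 (δ + E_F) ≤ lᵢ + Lmax` (`Lmax` any real; the program's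
`Lmax = max |L|`).  Then with
`ρ = α Lmax + (1 + α/2) δ`:
`min((lᵢ − ρ)/(1 + α), (lᵢ − ρ)/(1 − α)) − E_F ≤ λ↓ᵢ(S) ≤ max((lᵢ + ρ)/(1 − α), (lᵢ + ρ)/(1 + α)) + E_F`
— `certify.py: block_enclosures`. [cite: StewartSun1990, Thm IV.5.4] -/
theorem eigenvalues₀_mem_Icc_record {S A X : Matrix m m 𝕜} (hS : S.IsHermitian) (L : m → ℝ)
    {EF δ α Lmax : ℝ} (hEF : 0 ≤ EF) (hδ : 0 ≤ δ) (hα : 0 ≤ α) (hα2 : α ≤ 1 / 2)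
    (h0 : ∑ i, ∑ j, ‖(S - A) i j‖ ^ 2 ≤ EF ^ 2)
    (h1 : ∑ i, ∑ j, ‖(A * X - X * diagonal (fun j => ((L j : ℝ) : 𝕜))) i j‖ ^ 2 ≤ δ ^ 2)
    (hG : ∑ i, ∑ j, ‖(Xᴴ * X - 1) i j‖ ^ 2 ≤ α ^ 2) (i : Fin (Fintype.card m))
    (hside : 6 * (δ + EF) ≤ (EigenRadius.isHermitian_diagonal_ofReal (𝕜 := 𝕜) L).eigenvalues₀ i + Lmax) :
    hS.eigenvalues₀ i ∈ Set.Icc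
      (min (((EigenRadius.isHermitian_diagonal_ofReal (𝕜 := 𝕜) L).eigenvalues₀ i - (α * Lmax + (1 + α / 2) * δ)) / (1 + α))
           (((EigenRadius.isHermitian_diagonal_ofReal (𝕜 := 𝕜) L).eigenvalues₀ i - (α * Lmax + (1 + α / 2) * δ)) / (1 - α)) - EF)
      (max (((EigenRadius.isHermitian_diagonal_ofReal (𝕜 := 𝕜) L).eigenvalues₀ i + (α * Lmax + (1 + α / 2) * δ)) / (1 - α))
           (((EigenRadius.isHermitian_diagonal_ofReal (𝕜 := 𝕜) L).eigenvalues₀ i + (α * Lmax + (1 + α / 2) * δ)) / (1 + α)) + EF) := by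
  set l := (EigenRadius.isHermitian_diagonal_ofReal (𝕜 := 𝕜) L).eigenvalues₀ i with hl_def
  have hK := EigenRadius.abs_eigenvalues₀_sub_le_kahanRadius hS L hEF hδ hα (by linarith) h0 h1 hG i
  rw [← hl_def] at hK
  have hmaj := kahanRadius_le hα (by linarith) hδ hEF
  have hK' : |hS.eigenvalues₀ i - l| ≤ (δ + EF * (1 + α / 2)) / (1 - α) := hK.trans hmaj
  rw [abs_sub_le_iff] at hK'
  constructor
  · have hlo := lo_le_sub_majorant hα hα2 hδ hEF hside
    have hmin : min ((l - (α * Lmax + (1 + α / 2) * δ)) / (1 + α)) ((l - (α * Lmax + (1 + α / 2) * δ)) / (1 - α)) - EF ≤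
        (l - (α * Lmax + (1 + α / 2) * δ)) / (1 + α) - EF := by
      linarith [min_le_left ((l - (α * Lmax + (1 + α / 2) * δ)) / (1 + α)) ((l - (α * Lmax + (1 + α / 2) * δ)) / (1 - α))]
    linarith [hK'.2]
  · have hhi := add_majorant_le_hi hα hα2 hδ hEF hside
    have hmax : (l + (α * Lmax + (1 + α / 2) * δ)) / (1 - α) + EF ≤
        max ((l + (α * Lmax + (1 + α / 2) * δ)) / (1 - α)) ((l + (α * Lmax + (1 + α / 2) * δ)) / (1 + α)) + EF := by
      linarith [le_max_left ((l + (α * Lmax + (1 + α / 2) * δ)) / (1 - α)) ((l + (α * Lmax + (1 + α / 2) * δ)) / (1 + α))]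
    linarith [hK'.1]

end OstrowskiWeylRecord

end Summit.Ventures.YMGap.FlowData
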